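import Mathlib.LinearAlgebra.Matrix.Notation
import Mathlib.LinearAlgebra.Matrix.Trace
import Mathlib.LinearAlgebra.Matrix.Determinant.Basic
import Mathlib.Data.Real.Basic
import Mathlib.Tactic.FinCases
import Mathlib.Tactic.Linarith
import Mathlib.Tactic.LinearCombination
import Mathlib.Tactic.Ring
import Mathlib.Tactic.NormNum

/-!
# FunctionalMining/NoGo — crossed-shear pointwise algebra (no-go seat gen 11, STAGING for the prove seat)

HONEST FRAMING. Search for candidate a priori estimates; no regularity claim. NS FUNCTIONAL MINING —
NO-GO BRANCH (cell `pub-nsfunc`). Nothing about Navier–Stokes is asserted here.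

A *crossed shear* is a steady-data velocity field on `T³` of the form `v = (a(z), b(z), W(x))`
(divergence-free for all smooth `a, b, W`). At a point, with `a' = a'(z)`, `b' = b'(z)`, `W' = W'(x)`,
the velocity gradient `G i j = ∂ⱼ vᵢ` is `!![0, 0, a'; 0, 0, b'; W', 0, 0]`, so the strain
`S = ½(G + Gᵀ) = !![0, 0, p; 0, 0, q; p, q, 0]` with `p = (a' + W')/2`, `q = b'/2`, and the vorticity
is `ω = (−b', a' − W', 0)`.

The no-go branch's SIEVE K (§5, modulus-rigidity / tier-1 fields) and SIEVE Z0 (v1.3, erratum E9: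
the census witness `EAW1 = (a(z), b(z), 0.1 cos x)`) use three POINTWISE facts to certify that every
crossed shear lies in the classes `𝒵 = {λ₂(S) ≡ 0}` and `𝒵₀ = {σ := ω·Sω ≡ 0}`:

* `crossedShearStrain_mulVec_kernel` : `S (q, −p, 0)ᵀ = 0` — `0` is an eigenvalue;
* `crossedShearStrain_mulVec_top/bot` : `S (p, q, ±r)ᵀ = ±r (p, q, ±r)ᵀ` whenever `r² = p² + q²` —
  so the spectrum is `{r, 0, −r}` (`r = |(p, q)|`), the MIDDLE eigenvalue is `0`, and the strain
  spectrum is simple wherever `(p, q) ≠ 0` (for `EAW1`: everywhere, by the zero-free certificate);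
* `crossedShearStrain_sigma_eq_zero` : `ωᵀ S ω = 0` for every `ω` with `ω₃ = 0` — `σ ≡ 0`.

Also recorded: symmetry, `tr S = 0`, `det S = 0`, and the bookkeeping identities `S = ½(G + Gᵀ)`,
`ω = vorticityOfGrad G` with `ω₃ = 0` for the crossed-shear gradient. All proofs are `simp`/`ring`
over `Fin 3`; the file is self-contained (Mathlib only) so the prove seat can place it under
`Summits/NavierStokesRegularity/FunctionalMining/NoGo/` or inline it. [ours, bookkeeping]
-/

namespace Summit.NavierStokesRegularity.FunctionalMining.NoGo.CrossedShear

open Matrix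

/-- Velocity gradient `G i j = ∂ⱼvᵢ` of a crossed shear `(a(z), b(z), W(x))` at a point,
in terms of `a' = a'(z)`, `b' = b'(z)`, `W' = W'(x)`. [ours] -/
def grad (a' b' W' : ℝ) : Matrix (Fin 3) (Fin 3) ℝ := !![0, 0, a'; 0, 0, b'; W', 0, 0]

/-- The crossed-shear strain shape `!![0, 0, p; 0, 0, q; p, q, 0]`. [ours] -/
def strain (p q : ℝ) : Matrix (Fin 3) (Fin 3) ℝ := !![0, 0, p; 0, 0, q; p, q, 0]

/-- Vorticity from a velocity gradient `G i j = ∂ⱼvᵢ`: `ω = (∂₂v₃ − ∂₃v₂, ∂₃v₁ − ∂₁v₃, ∂₁v₂ − ∂₂v₁)`. [folklore] -/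
def vorticityOfGrad (G : Matrix (Fin 3) (Fin 3) ℝ) : Fin 3 → ℝ :=
  ![G 2 1 - G 1 2, G 0 2 - G 2 0, G 1 0 - G 0 1]

/-- `tr G = 0`: a crossed shear is divergence-free at every point. [ours, bookkeeping] -/
theorem grad_trace (a' b' W' : ℝ) : (grad a' b' W').trace = 0 := by
  simp [grad, Matrix.trace, Fin.sum_univ_three]

/-- `S = ½(G + Gᵀ)` is the crossed-shear strain shape with `p = (a' + W')/2`, `q = b'/2`. [ours, bookkeeping] -/
theorem strain_eq_symm_grad (a' b' W' : ℝ) :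
    (1 / 2 : ℝ) • (grad a' b' W' + (grad a' b' W')ᵀ) = strain ((a' + W') / 2) (b' / 2) := by
  ext i j
  simp only [Matrix.smul_apply, Matrix.add_apply, Matrix.transpose_apply, smul_eq_mul]
  fin_cases i <;> fin_cases j <;> simp [grad, strain] <;> ring

/-- The vorticity of a crossed shear is `(−b', a' − W', 0)`; in particular `ω₃ = 0`. [ours, bookkeeping] -/
theorem vorticity_grad (a' b' W' : ℝ) : vorticityOfGrad (grad a' b' W') = ![-b', a' - W', 0] := by
  ext i
  fin_cases i <;> simp [vorticityOfGrad, grad]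

/-- The strain shape is symmetric. [ours, bookkeeping] -/
theorem strain_transpose (p q : ℝ) : (strain p q)ᵀ = strain p q := by
  ext i j
  fin_cases i <;> fin_cases j <;> simp [strain]

/-- `tr S = 0`. [ours, bookkeeping] -/
theorem strain_trace (p q : ℝ) : (strain p q).trace = 0 := by
  simp [strain, Matrix.trace, Fin.sum_univ_three]

/-- `det S = 0`: `0` is an eigenvalue of every crossed-shear strain. [ours, bookkeeping] -/
theorem strain_det (p q : ℝ) : (strain p q).det = 0 := by
  simp [strain, Matrix.det_fin_three]

/-- The kernel vector: `S (q, −p, 0)ᵀ = 0`. [ours] -/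
theorem strain_mulVec_kernel (p q : ℝ) : (strain p q) *ᵥ ![q, -p, 0] = 0 := by
  ext i
  fin_cases i <;> simp [strain, Matrix.mulVec, dotProduct, Fin.sum_univ_three]
  ring1

/-- Top eigenpair: `S (p, q, r)ᵀ = r (p, q, r)ᵀ` when `r² = p² + q²`. [ours] -/
theorem strain_mulVec_top (p q r : ℝ) (hr : r ^ 2 = p ^ 2 + q ^ 2) :
    (strain p q) *ᵥ ![p, q, r] = r • ![p, q, r] := by
  ext i
  fin_cases i <;> simp [strain, Matrix.mulVec, dotProduct, Fin.sum_univ_three] <;>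
    first | ring1 | linear_combination -hr

/-- Bottom eigenpair: `S (p, q, −r)ᵀ = −r (p, q, −r)ᵀ` when `r² = p² + q²`. [ours] -/
theorem strain_mulVec_bot (p q r : ℝ) (hr : r ^ 2 = p ^ 2 + q ^ 2) :
    (strain p q) *ᵥ ![p, q, -r] = (-r) • ![p, q, -r] := by
  ext i
  fin_cases i <;> simp [strain, Matrix.mulVec, dotProduct, Fin.sum_univ_three] <;>
    first | ring1 | linear_combination -hr

/-- `σ = ωᵀ S ω = 0` for every `ω` with vanishing third component — every crossed shear has
stretching density `σ ≡ 0` (class `𝒵₀` of SIEVE Z0). [ours] -/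
theorem strain_sigma_eq_zero (p q w₁ w₂ : ℝ) :
    ![w₁, w₂, 0] ⬝ᵥ ((strain p q) *ᵥ ![w₁, w₂, 0]) = 0 := by
  simp [strain, Matrix.mulVec, dotProduct, Fin.sum_univ_three]

/-- The three eigen-relations together: for `r² = p² + q²` the vectors `(p,q,r)`, `(q,−p,0)`, `(p,q,−r)`
are eigenvectors with eigenvalues `r, 0, −r`, and they are pairwise orthogonal. With `r > 0` this is an
orthogonal eigenbasis, so the sorted spectrum of the crossed-shear strain is `(r, 0, −r)`:
the MIDDLE eigenvalue is `0` (class `𝒵` of SIEVE K) and the spectrum is simple. [ours] -/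
theorem strain_eigen_orthogonal (p q r : ℝ) (hr : r ^ 2 = p ^ 2 + q ^ 2) :
    (strain p q) *ᵥ ![p, q, r] = r • ![p, q, r] ∧ (strain p q) *ᵥ ![q, -p, 0] = 0 ∧
    (strain p q) *ᵥ ![p, q, -r] = (-r) • ![p, q, -r] ∧
    ![p, q, r] ⬝ᵥ ![q, -p, 0] = 0 ∧ ![p, q, r] ⬝ᵥ ![p, q, -r] = 0 ∧ ![q, -p, 0] ⬝ᵥ ![p, q, -r] = 0 := by
  refine ⟨strain_mulVec_top p q r hr, strain_mulVec_kernel p q, strain_mulVec_bot p q r hr, ?_, ?_, ?_⟩ <;>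
    simp [dotProduct, Fin.sum_univ_three] <;> first | ring1 | linear_combination -hr

/-- Crossed-shear corollary in gradient variables: with `G = grad a' b' W'`, `S = ½(G + Gᵀ)` and
`ω = vorticityOfGrad G`, the stretching density vanishes: `ω ⬝ᵥ (S *ᵥ ω) = 0`. [ours] -/
theorem crossedShear_sigma_eq_zero (a' b' W' : ℝ) :
    vorticityOfGrad (grad a' b' W') ⬝ᵥ
      (((1 / 2 : ℝ) • (grad a' b' W' + (grad a' b' W')ᵀ)) *ᵥ vorticityOfGrad (grad a' b' W')) = 0 := by
  rw [strain_eq_symm_grad, vorticity_grad]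
  exact strain_sigma_eq_zero _ _ _ _

end Summit.NavierStokesRegularity.FunctionalMining.NoGo.CrossedShear
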